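import Summits.MatrixMultiplication.MatrixMultiplication.Theses.ProbeRankThreshold

/-!
# MatrixMultiplication / ProbeRankThreshold — `PanAggregation`

Route `MatrixMultiplication/ProbeRankThreshold`, item `stmt-MatrixMultiplication-6605` (support):
for every `m`, the matrix multiplication tensor `⟨2m, 2m, 2m⟩` is a sum of `4m³ + 12m²` triads all
of whose probes (the three legs of a triad, read as `2m × 2m` matrices) have rank `≤ 2`.

Construction (Pan 1972 / Pan 1984 §4, two-fold "trilinear aggregating", tensored once with
`⟨2,2,2⟩`): an index of `Fin (2m)` is a block `c ∈ Fin 2` and a position `i ∈ Fin m`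
(`finProdFinEquiv (c, i)`); the trilinear form `∑ x_{κμ} y_{μν} z_{κν}` of `⟨2m,2m,2m⟩` is the sum
of `8` block products `(κ₀, μ₀, ν₀)`, and the pair `(κ₀, μ₀, 0)`, `(κ₀, μ₀, 1)` is computed by Pan's
identity (`pan_pair`; `a, b, c` the blocks of the first product, `u, v, w` of the second)
  `∑_{ijk} (a_{ij}+u_{jk})(b_{jk}+v_{ki})(c_{ki}+w_{ij}) − ∑_{ij} a_{ij} (∑_k b_{jk}+v_{ki}) w_{ij}`
  `− ∑_{ki} (∑_j a_{ij} + u_{jk}) v_{ki} c_{ki} − ∑_{jk} u_{jk} b_{jk} (∑_i c_{ki} + w_{ij})`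
  `= ∑_{ijk} a_{ij} b_{jk} c_{ki} + ∑_{ijk} u_{jk} v_{ki} w_{ij}`
with `m³ + 3m²` products; every linear form is supported on `≤ 2` entries or on one entry plus one
row/column segment of a block, so its coefficient matrix is a sum of `≤ 2` rank-one matrices
(`Matrix.vecMulVec`).  Four pairs give `4m³ + 12m²` triads, indexed by
`Fin 2 × Fin 2 × (m³ ⊕ m² ⊕ m² ⊕ m²)`; the tensor identity follows from the polynomial identity by
evaluating the generic trilinear identity at indicator vectors.  The explicit probes are witnesses
inside the proof of `exists_pan_decomposition` (no new definitions are introduced).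
References: Pan 1984, §4 (eqs. (4.1)–(4.3)); Pan 1978; Kronsjö 1986, pp. 16–20.
-/

noncomputable section

-- single-conjunct summit: the `Summit.<S>.<P>` prefix repeats `MatrixMultiplication` (D-0017)
set_option linter.dupNamespace false

namespace Summit.MatrixMultiplication.MatrixMultiplication.Theorems

open scoped BigOperators
open Literature.Computability.AlgebraicComplexity

namespace PanAggregation

/-! ## Pan's two-fold aggregation identity (abstract form) -/

section PanIdentity

variable {R : Type*} [CommRing R] {ι : Type*} [Fintype ι]

/-- Reordering a triple sum, `∑_k ∑_i ∑_j → ∑_i ∑_j ∑_k`. [folklore] -/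
theorem sum_comm3_kij (f : ι → ι → ι → R) :
    ∑ k, ∑ i, ∑ j, f i j k = ∑ i, ∑ j, ∑ k, f i j k := by
  calc ∑ k, ∑ i, ∑ j, f i j k = ∑ i, ∑ k, ∑ j, f i j k := Finset.sum_comm
    _ = ∑ i, ∑ j, ∑ k, f i j k := Finset.sum_congr rfl fun i _ => Finset.sum_comm

/-- Reordering a triple sum, `∑_j ∑_k ∑_i → ∑_i ∑_j ∑_k`. [folklore] -/
theorem sum_comm3_jki (f : ι → ι → ι → R) :
    ∑ j, ∑ k, ∑ i, f i j k = ∑ i, ∑ j, ∑ k, f i j k := by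
  calc ∑ j, ∑ k, ∑ i, f i j k = ∑ j, ∑ i, ∑ k, f i j k :=
        Finset.sum_congr rfl fun j _ => Finset.sum_comm
    _ = ∑ i, ∑ j, ∑ k, f i j k := Finset.sum_comm

/-- **Pan's two-fold trilinear aggregation identity** (Pan 1984, §4, eqs. (4.1)–(4.3)): the
`m³` aggregates `(a_{ij}+u_{jk})(b_{jk}+v_{ki})(c_{ki}+w_{ij})` compute the two disjoint matrix
products `∑ a_{ij} b_{jk} c_{ki}` and `∑ u_{jk} v_{ki} w_{ij}` up to three correction sums, each of
which aggregates into `m²` products. [cite: Pan1984, §4] -/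
theorem pan_pair (a b c u v w : ι → ι → R) :
    ∑ i, ∑ j, ∑ k, (a i j + u j k) * (b j k + v k i) * (c k i + w i j)
      = (∑ i, ∑ j, ∑ k, a i j * b j k * c k i) + (∑ i, ∑ j, ∑ k, u j k * v k i * w i j)
        + (∑ i, ∑ j, a i j * ((∑ k, b j k) + (∑ k, v k i)) * w i j)
        + (∑ k, ∑ i, ((∑ j, a i j) + (∑ j, u j k)) * v k i * c k i)
        + (∑ j, ∑ k, u j k * b j k * ((∑ i, c k i) + (∑ i, w i j))) := by
  have h1 : ∑ i, ∑ j, a i j * ((∑ k, b j k) + (∑ k, v k i)) * w i j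
      = (∑ i, ∑ j, ∑ k, a i j * b j k * w i j) + (∑ i, ∑ j, ∑ k, a i j * v k i * w i j) := by
    simp only [mul_add, add_mul, Finset.mul_sum, Finset.sum_mul, Finset.sum_add_distrib]
  have h2 : ∑ k, ∑ i, ((∑ j, a i j) + (∑ j, u j k)) * v k i * c k i
      = (∑ i, ∑ j, ∑ k, a i j * v k i * c k i) + (∑ i, ∑ j, ∑ k, u j k * v k i * c k i) := by
    simp only [add_mul, Finset.sum_mul, Finset.sum_add_distrib]
    rw [sum_comm3_kij (fun i j k => a i j * v k i * c k i),
      sum_comm3_kij (fun i j k => u j k * v k i * c k i)]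
  have h3 : ∑ j, ∑ k, u j k * b j k * ((∑ i, c k i) + (∑ i, w i j))
      = (∑ i, ∑ j, ∑ k, u j k * b j k * c k i) + (∑ i, ∑ j, ∑ k, u j k * b j k * w i j) := by
    simp only [mul_add, Finset.mul_sum, Finset.sum_add_distrib]
    rw [sum_comm3_jki (fun i j k => u j k * b j k * c k i),
      sum_comm3_jki (fun i j k => u j k * b j k * w i j)]
  rw [h1, h2, h3]
  simp only [add_mul, mul_add, Finset.sum_add_distrib]
  abel

/-- Pan's identity in the signed shape used by the decomposition below (corrections carry the
sign on their first factor; the second product is re-indexed cyclically). [cite: Pan1984, §4] -/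
theorem pan_pair_neg (a b c u v w : ι → ι → R) :
    (∑ i, ∑ j, ∑ k, (a i j + u j k) * (b j k + v k i) * (c k i + w i j))
      + ((∑ i, ∑ j, (-a i j) * ((∑ k, b j k) + (∑ k, v k i)) * w i j)
        + ((∑ k, ∑ i, (-((∑ j, a i j) + (∑ j, u j k))) * v k i * c k i)
          + (∑ j, ∑ k, (-u j k) * b j k * ((∑ i, c k i) + (∑ i, w i j)))))
      = (∑ i, ∑ j, ∑ k, a i j * b j k * c k i) + (∑ i, ∑ j, ∑ k, u i j * v j k * w k i) := by
  have h := pan_pair a b c u v w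
  have hc : ∑ i, ∑ j, ∑ k, u j k * v k i * w i j = ∑ i, ∑ j, ∑ k, u i j * v j k * w k i :=
    sum_comm3_kij (fun i j k => u i j * v j k * w k i)
  simp only [neg_mul, Finset.sum_neg_distrib]
  rw [h, hc]
  abel

end PanIdentity

/-! ## Block indices, indicator vectors, probe ranks -/

/-- Sums over `Fin 2`. [folklore] -/
theorem sum_two {M : Type*} [AddCommMonoid M] (f : Fin 2 → M) : ∑ c, f c = f 0 + f 1 :=
  Fin.sum_univ_two f

/-- A sum over `Fin (2m)` splits into the two blocks. [folklore] -/
theorem sum_fin_two_mul {M : Type*} [AddCommMonoid M] (m : ℕ) (f : Fin (2 * m) → M) :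
    ∑ p, f p = (∑ i : Fin m, f (finProdFinEquiv ((0 : Fin 2), i)))
      + (∑ i : Fin m, f (finProdFinEquiv ((1 : Fin 2), i))) := by
  rw [← Equiv.sum_comp finProdFinEquiv, Fintype.sum_prod_type, Fin.sum_univ_two]

/-- Pairing with an indicator vector. [folklore] -/
theorem sum_single_mul {n : ℕ} (a : Fin n) (h : Fin n → ℂ) :
    ∑ p, (Pi.single a (1 : ℂ) : Fin n → ℂ) p * h p = h a := by
  simp only [Pi.single_apply, ite_mul, one_mul, zero_mul, Finset.sum_ite_eq', Finset.mem_univ,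
    if_true]

/-- Pairing with the indicator vector of a block of `Fin (2m)`. [folklore] -/
theorem sum_block_mul (m : ℕ) (c : Fin 2) (h : Fin (2 * m) → ℂ) :
    ∑ p, (∑ k : Fin m, (Pi.single (finProdFinEquiv (c, k)) (1 : ℂ) : Fin (2 * m) → ℂ)) p * h p
      = ∑ k, h (finProdFinEquiv (c, k)) := by
  simp only [Finset.sum_apply, Finset.sum_mul]
  rw [Finset.sum_comm]
  simp only [Pi.single_apply, ite_mul, one_mul, zero_mul, Finset.sum_ite_eq', Finset.mem_univ,
    if_true]

/-- Pairing a rank-one matrix `f ⊗ g`, read as a vector on `Fin n × Fin n`, with `x`. [folklore] -/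
theorem sum_vecMulVec_mul {n : ℕ} (f g : Fin n → ℂ) (x : Fin n × Fin n → ℂ) :
    ∑ b : Fin n × Fin n, Matrix.vecMulVec f g b.1 b.2 * x b = ∑ p, f p * ∑ q, g q * x (p, q) := by
  rw [Fintype.sum_prod_type]
  simp only [Matrix.vecMulVec_apply, Finset.mul_sum, mul_assoc]

/-- The entries of `⟨2m,2m,2m⟩` as values of its trilinear form at indicator vectors. [folklore] -/
theorem matMulTensor_entry (m : ℕ) (a b c : Fin (2 * m) × Fin (2 * m)) :
    ∑ κ : Fin (2 * m), ∑ μ : Fin (2 * m), ∑ ν : Fin (2 * m),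
        (if b = (κ, μ) then (1 : ℂ) else 0) * (if c = (μ, ν) then (1 : ℂ) else 0)
          * (if a = (κ, ν) then (1 : ℂ) else 0)
      = matMulTensor ℂ (2 * m) (2 * m) (2 * m) a b c := by
  obtain ⟨a1, a2⟩ := a
  obtain ⟨b1, b2⟩ := b
  obtain ⟨c1, c2⟩ := c
  simp only [matMulTensor, Prod.mk.injEq]
  rw [Fintype.sum_eq_single b1, Fintype.sum_eq_single c1, Fintype.sum_eq_single c2]
  · by_cases h1 : a1 = b1 <;> by_cases h2 : b2 = c1 <;> by_cases h3 : a2 = c2 <;> simp [h1, h2, h3]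
  all_goals intro t ht; simp [Ne.symm ht]

/-- A sum of two rank-one matrices has rank `≤ 2` (sub-additivity of rank over a field and
`Matrix.rank_vecMulVec_le`). [folklore] -/
theorem rank_vecMulVec_add_le {n : ℕ} (f g f' g' : Fin n → ℂ) :
    (Matrix.vecMulVec f g + Matrix.vecMulVec f' g').rank ≤ 2 := by
  have h : (Matrix.vecMulVec f g + Matrix.vecMulVec f' g').rank
      ≤ (Matrix.vecMulVec f g).rank + (Matrix.vecMulVec f' g').rank := by
    unfold Matrix.rank
    rw [Matrix.mulVecLin_add]
    exact (Submodule.finrank_mono (LinearMap.range_add_le _ _)).trans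
      (Submodule.finrank_add_le_finrank_add_finrank _ _)
  exact h.trans (add_le_add (Matrix.rank_vecMulVec_le _ _) (Matrix.rank_vecMulVec_le _ _))

/-! ## The decomposition over the structured index set -/

/-- **Pan's aggregation, tensored once** (structured index set): `⟨2m,2m,2m⟩` is a sum of triads
indexed by `Fin 2 × Fin 2 × (m³ ⊕ m² ⊕ m² ⊕ m²)` (four aggregation pairs: `m³` aggregates and three
families of `m²` corrections each), all probes of rank `≤ 2`; the witnesses `MW`, `MU`, `MV` are
the coefficient matrices of Pan's linear forms after block placement. [cite: Pan1984, §4] -/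
theorem exists_pan_decomposition (m : ℕ) :
    ∃ (W U V : Fin 2 × Fin 2 × ((Fin m × Fin m × Fin m) ⊕ (Fin m × Fin m) ⊕ (Fin m × Fin m)
          ⊕ (Fin m × Fin m)) → Fin (2 * m) × Fin (2 * m) → ℂ),
      matMulTensor ℂ (2 * m) (2 * m) (2 * m) = ∑ s, triad (W s) (U s) (V s) ∧
      ∀ s, (Matrix.of fun p q => W s (p, q)).rank ≤ 2 ∧ (Matrix.of fun p q => U s (p, q)).rank ≤ 2
        ∧ (Matrix.of fun p q => V s (p, q)).rank ≤ 2 := by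
  /- Probes for the pair `(κ₀, μ₀)` and term kinds `inl (i,j,k)` (aggregate), `inr (inl (i,j))`,
     `inr (inr (inl (k,i)))`, `inr (inr (inr (j,k)))` (corrections); `finProdFinEquiv (c, i)` is
     position `i` of block `c`. -/
  let MU : Fin 2 → Fin 2 → ((Fin m × Fin m × Fin m) ⊕ (Fin m × Fin m) ⊕ (Fin m × Fin m)
      ⊕ (Fin m × Fin m)) → Matrix (Fin (2 * m)) (Fin (2 * m)) ℂ := fun κ₀ μ₀ =>
    Sum.elim
      (fun ijk =>
        Matrix.vecMulVec (Pi.single (finProdFinEquiv (κ₀, ijk.1)) 1)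
            (Pi.single (finProdFinEquiv (μ₀, ijk.2.1)) 1)
          + Matrix.vecMulVec (Pi.single (finProdFinEquiv (κ₀, ijk.2.1)) 1)
            (Pi.single (finProdFinEquiv (μ₀, ijk.2.2)) 1))
      (Sum.elim
        (fun ij =>
          Matrix.vecMulVec (-Pi.single (finProdFinEquiv (κ₀, ij.1)) 1)
            (Pi.single (finProdFinEquiv (μ₀, ij.2)) 1))
        (Sum.elim
          (fun ki =>
            Matrix.vecMulVec (-Pi.single (finProdFinEquiv (κ₀, ki.2)) 1)
                (∑ l : Fin m, Pi.single (finProdFinEquiv (μ₀, l)) 1)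
              + Matrix.vecMulVec (-∑ l : Fin m, Pi.single (finProdFinEquiv (κ₀, l)) 1)
                (Pi.single (finProdFinEquiv (μ₀, ki.1)) 1))
          (fun jk =>
            Matrix.vecMulVec (-Pi.single (finProdFinEquiv (κ₀, jk.1)) 1)
              (Pi.single (finProdFinEquiv (μ₀, jk.2)) 1))))
  let MV : Fin 2 → ((Fin m × Fin m × Fin m) ⊕ (Fin m × Fin m) ⊕ (Fin m × Fin m)
      ⊕ (Fin m × Fin m)) → Matrix (Fin (2 * m)) (Fin (2 * m)) ℂ := fun μ₀ =>
    Sum.elim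
      (fun ijk =>
        Matrix.vecMulVec (Pi.single (finProdFinEquiv (μ₀, ijk.2.1)) 1)
            (Pi.single (finProdFinEquiv ((0 : Fin 2), ijk.2.2)) 1)
          + Matrix.vecMulVec (Pi.single (finProdFinEquiv (μ₀, ijk.2.2)) 1)
            (Pi.single (finProdFinEquiv ((1 : Fin 2), ijk.1)) 1))
      (Sum.elim
        (fun ij =>
          Matrix.vecMulVec (Pi.single (finProdFinEquiv (μ₀, ij.2)) 1)
              (∑ l : Fin m, Pi.single (finProdFinEquiv ((0 : Fin 2), l)) 1)
            + Matrix.vecMulVec (∑ l : Fin m, Pi.single (finProdFinEquiv (μ₀, l)) 1)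
              (Pi.single (finProdFinEquiv ((1 : Fin 2), ij.1)) 1))
        (Sum.elim
          (fun ki =>
            Matrix.vecMulVec (Pi.single (finProdFinEquiv (μ₀, ki.1)) 1)
              (Pi.single (finProdFinEquiv ((1 : Fin 2), ki.2)) 1))
          (fun jk =>
            Matrix.vecMulVec (Pi.single (finProdFinEquiv (μ₀, jk.1)) 1)
              (Pi.single (finProdFinEquiv ((0 : Fin 2), jk.2)) 1))))
  let MW : Fin 2 → ((Fin m × Fin m × Fin m) ⊕ (Fin m × Fin m) ⊕ (Fin m × Fin m)
      ⊕ (Fin m × Fin m)) → Matrix (Fin (2 * m)) (Fin (2 * m)) ℂ := fun κ₀ =>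
    Sum.elim
      (fun ijk =>
        Matrix.vecMulVec (Pi.single (finProdFinEquiv (κ₀, ijk.1)) 1)
            (Pi.single (finProdFinEquiv ((0 : Fin 2), ijk.2.2)) 1)
          + Matrix.vecMulVec (Pi.single (finProdFinEquiv (κ₀, ijk.2.1)) 1)
            (Pi.single (finProdFinEquiv ((1 : Fin 2), ijk.1)) 1))
      (Sum.elim
        (fun ij =>
          Matrix.vecMulVec (Pi.single (finProdFinEquiv (κ₀, ij.2)) 1)
            (Pi.single (finProdFinEquiv ((1 : Fin 2), ij.1)) 1))
        (Sum.elim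
          (fun ki =>
            Matrix.vecMulVec (Pi.single (finProdFinEquiv (κ₀, ki.2)) 1)
              (Pi.single (finProdFinEquiv ((0 : Fin 2), ki.1)) 1))
          (fun jk =>
            Matrix.vecMulVec (∑ l : Fin m, Pi.single (finProdFinEquiv (κ₀, l)) 1)
                (Pi.single (finProdFinEquiv ((0 : Fin 2), jk.2)) 1)
              + Matrix.vecMulVec (Pi.single (finProdFinEquiv (κ₀, jk.1)) 1)
                (∑ l : Fin m, Pi.single (finProdFinEquiv ((1 : Fin 2), l)) 1))))
  -- the linear forms of the three factors, evaluated at inputs `x`, `y`, `z`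
  let LU : Fin 2 → Fin 2 → (Fin (2 * m) × Fin (2 * m) → ℂ) → ((Fin m × Fin m × Fin m)
      ⊕ (Fin m × Fin m) ⊕ (Fin m × Fin m) ⊕ (Fin m × Fin m)) → ℂ := fun κ₀ μ₀ x =>
    Sum.elim
      (fun ijk =>
        x (finProdFinEquiv (κ₀, ijk.1), finProdFinEquiv (μ₀, ijk.2.1))
          + x (finProdFinEquiv (κ₀, ijk.2.1), finProdFinEquiv (μ₀, ijk.2.2)))
      (Sum.elim (fun ij => -x (finProdFinEquiv (κ₀, ij.1), finProdFinEquiv (μ₀, ij.2)))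
        (Sum.elim
          (fun ki =>
            -((∑ j, x (finProdFinEquiv (κ₀, ki.2), finProdFinEquiv (μ₀, j)))
              + (∑ j, x (finProdFinEquiv (κ₀, j), finProdFinEquiv (μ₀, ki.1)))))
          (fun jk => -x (finProdFinEquiv (κ₀, jk.1), finProdFinEquiv (μ₀, jk.2)))))
  let LV : Fin 2 → (Fin (2 * m) × Fin (2 * m) → ℂ) → ((Fin m × Fin m × Fin m)
      ⊕ (Fin m × Fin m) ⊕ (Fin m × Fin m) ⊕ (Fin m × Fin m)) → ℂ := fun μ₀ y =>
    Sum.elim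
      (fun ijk =>
        y (finProdFinEquiv (μ₀, ijk.2.1), finProdFinEquiv ((0 : Fin 2), ijk.2.2))
          + y (finProdFinEquiv (μ₀, ijk.2.2), finProdFinEquiv ((1 : Fin 2), ijk.1)))
      (Sum.elim
        (fun ij =>
          (∑ k, y (finProdFinEquiv (μ₀, ij.2), finProdFinEquiv ((0 : Fin 2), k)))
            + (∑ k, y (finProdFinEquiv (μ₀, k), finProdFinEquiv ((1 : Fin 2), ij.1))))
        (Sum.elim
          (fun ki => y (finProdFinEquiv (μ₀, ki.1), finProdFinEquiv ((1 : Fin 2), ki.2)))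
          (fun jk => y (finProdFinEquiv (μ₀, jk.1), finProdFinEquiv ((0 : Fin 2), jk.2)))))
  let LW : Fin 2 → (Fin (2 * m) × Fin (2 * m) → ℂ) → ((Fin m × Fin m × Fin m)
      ⊕ (Fin m × Fin m) ⊕ (Fin m × Fin m) ⊕ (Fin m × Fin m)) → ℂ := fun κ₀ z =>
    Sum.elim
      (fun ijk =>
        z (finProdFinEquiv (κ₀, ijk.1), finProdFinEquiv ((0 : Fin 2), ijk.2.2))
          + z (finProdFinEquiv (κ₀, ijk.2.1), finProdFinEquiv ((1 : Fin 2), ijk.1)))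
      (Sum.elim
        (fun ij => z (finProdFinEquiv (κ₀, ij.2), finProdFinEquiv ((1 : Fin 2), ij.1)))
        (Sum.elim
          (fun ki => z (finProdFinEquiv (κ₀, ki.2), finProdFinEquiv ((0 : Fin 2), ki.1)))
          (fun jk =>
            (∑ i, z (finProdFinEquiv (κ₀, i), finProdFinEquiv ((0 : Fin 2), jk.2)))
              + (∑ i, z (finProdFinEquiv (κ₀, jk.1), finProdFinEquiv ((1 : Fin 2), i))))))
  -- one block product of `⟨2m,2m,2m⟩`, as a trilinear form
  let B : (Fin (2 * m) × Fin (2 * m) → ℂ) → (Fin (2 * m) × Fin (2 * m) → ℂ)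
      → (Fin (2 * m) × Fin (2 * m) → ℂ) → Fin 2 → Fin 2 → Fin 2 → ℂ := fun x y z κ₀ μ₀ ν₀ =>
    ∑ i : Fin m, ∑ j : Fin m, ∑ k : Fin m,
      x (finProdFinEquiv (κ₀, i), finProdFinEquiv (μ₀, j))
        * y (finProdFinEquiv (μ₀, j), finProdFinEquiv (ν₀, k))
        * z (finProdFinEquiv (κ₀, i), finProdFinEquiv (ν₀, k))
  -- the probes are the coefficient vectors of the forms; one aggregation pair computes the block
  -- products `(κ₀, μ₀, 0)`, `(κ₀, μ₀, 1)` (`pair_sum`); all of them give `⟨2m,2m,2m⟩` (`sum_forms`)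
  have pair_U : ∀ (κ₀ μ₀ : Fin 2) t (x : Fin (2 * m) × Fin (2 * m) → ℂ),
      ∑ b, MU κ₀ μ₀ t b.1 b.2 * x b = LU κ₀ μ₀ x t := by
    intro κ₀ μ₀ t x
    rcases t with ⟨i, j, k⟩ | ⟨i, j⟩ | ⟨k, i⟩ | ⟨j, k⟩ <;>
      simp only [MU, LU, Sum.elim_inl, Sum.elim_inr, Matrix.add_apply, add_mul,
        Finset.sum_add_distrib, sum_vecMulVec_mul, Pi.neg_apply, neg_mul, Finset.sum_neg_distrib,
        sum_single_mul, sum_block_mul]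
    -- the remaining case (second correction family): `-A + -B = -(A + B)`
    ring
  have pair_V : ∀ (μ₀ : Fin 2) t (y : Fin (2 * m) × Fin (2 * m) → ℂ),
      ∑ b, MV μ₀ t b.1 b.2 * y b = LV μ₀ y t := by
    intro μ₀ t y
    rcases t with ⟨i, j, k⟩ | ⟨i, j⟩ | ⟨k, i⟩ | ⟨j, k⟩ <;>
      simp only [MV, LV, Sum.elim_inl, Sum.elim_inr, Matrix.add_apply, add_mul,
        Finset.sum_add_distrib, sum_vecMulVec_mul, sum_single_mul, sum_block_mul]
  have pair_W : ∀ (κ₀ : Fin 2) t (z : Fin (2 * m) × Fin (2 * m) → ℂ),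
      ∑ b, MW κ₀ t b.1 b.2 * z b = LW κ₀ z t := by
    intro κ₀ t z
    rcases t with ⟨i, j, k⟩ | ⟨i, j⟩ | ⟨k, i⟩ | ⟨j, k⟩ <;>
      simp only [MW, LW, Sum.elim_inl, Sum.elim_inr, Matrix.add_apply, add_mul,
        Finset.sum_add_distrib, sum_vecMulVec_mul, sum_single_mul, sum_block_mul]
  have pair_sum : ∀ (κ₀ μ₀ : Fin 2) (x y z : Fin (2 * m) × Fin (2 * m) → ℂ),
      ∑ t, LU κ₀ μ₀ x t * LV μ₀ y t * LW κ₀ z t = B x y z κ₀ μ₀ 0 + B x y z κ₀ μ₀ 1 := by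
    intro κ₀ μ₀ x y z
    simp only [Fintype.sum_sum_type, Fintype.sum_prod_type, LU, LV, LW, B, Sum.elim_inl,
      Sum.elim_inr]
    exact pan_pair_neg (fun i j => x (finProdFinEquiv (κ₀, i), finProdFinEquiv (μ₀, j)))
      (fun j k => y (finProdFinEquiv (μ₀, j), finProdFinEquiv ((0 : Fin 2), k)))
      (fun k i => z (finProdFinEquiv (κ₀, i), finProdFinEquiv ((0 : Fin 2), k)))
      (fun j k => x (finProdFinEquiv (κ₀, j), finProdFinEquiv (μ₀, k)))
      (fun k i => y (finProdFinEquiv (μ₀, k), finProdFinEquiv ((1 : Fin 2), i)))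
      (fun i j => z (finProdFinEquiv (κ₀, j), finProdFinEquiv ((1 : Fin 2), i)))
  have sum_forms : ∀ x y z : Fin (2 * m) × Fin (2 * m) → ℂ,
      ∑ s : Fin 2 × Fin 2 × ((Fin m × Fin m × Fin m) ⊕ (Fin m × Fin m) ⊕ (Fin m × Fin m)
          ⊕ (Fin m × Fin m)), LU s.1 s.2.1 x s.2.2 * LV s.2.1 y s.2.2 * LW s.1 z s.2.2
        = ∑ κ : Fin (2 * m), ∑ μ : Fin (2 * m), ∑ ν : Fin (2 * m),
            x (κ, μ) * y (μ, ν) * z (κ, ν) := by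
    intro x y z
    simp only [Fintype.sum_prod_type, pair_sum, sum_two, B, sum_fin_two_mul,
      Finset.sum_add_distrib]
  -- evaluating the forms at indicator vectors returns the probe entries; probe ranks; assembly
  have LU_ind : ∀ (κ₀ μ₀ : Fin 2) t (b : Fin (2 * m) × Fin (2 * m)),
      LU κ₀ μ₀ (fun b' => if b = b' then 1 else 0) t = MU κ₀ μ₀ t b.1 b.2 := fun κ₀ μ₀ t b => by
    simpa only [mul_ite, mul_one, mul_zero, Finset.sum_ite_eq, Finset.mem_univ, if_true] using
      (pair_U κ₀ μ₀ t (fun b' => if b = b' then 1 else 0)).symm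
  have LV_ind : ∀ (μ₀ : Fin 2) t (b : Fin (2 * m) × Fin (2 * m)),
      LV μ₀ (fun b' => if b = b' then 1 else 0) t = MV μ₀ t b.1 b.2 := fun μ₀ t b => by
    simpa only [mul_ite, mul_one, mul_zero, Finset.sum_ite_eq, Finset.mem_univ, if_true] using
      (pair_V μ₀ t (fun b' => if b = b' then 1 else 0)).symm
  have LW_ind : ∀ (κ₀ : Fin 2) t (b : Fin (2 * m) × Fin (2 * m)),
      LW κ₀ (fun b' => if b = b' then 1 else 0) t = MW κ₀ t b.1 b.2 := fun κ₀ t b => by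
    simpa only [mul_ite, mul_one, mul_zero, Finset.sum_ite_eq, Finset.mem_univ, if_true] using
      (pair_W κ₀ t (fun b' => if b = b' then 1 else 0)).symm
  have rank_MU : ∀ κ₀ μ₀ t, (MU κ₀ μ₀ t).rank ≤ 2 := by
    rintro κ₀ μ₀ (⟨i, j, k⟩ | ⟨i, j⟩ | ⟨k, i⟩ | ⟨j, k⟩)
    · exact rank_vecMulVec_add_le _ _ _ _
    · exact (Matrix.rank_vecMulVec_le _ _).trans one_le_two
    · exact rank_vecMulVec_add_le _ _ _ _
    · exact (Matrix.rank_vecMulVec_le _ _).trans one_le_two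
  have rank_MV : ∀ μ₀ t, (MV μ₀ t).rank ≤ 2 := by
    rintro μ₀ (⟨i, j, k⟩ | ⟨i, j⟩ | ⟨k, i⟩ | ⟨j, k⟩)
    · exact rank_vecMulVec_add_le _ _ _ _
    · exact rank_vecMulVec_add_le _ _ _ _
    · exact (Matrix.rank_vecMulVec_le _ _).trans one_le_two
    · exact (Matrix.rank_vecMulVec_le _ _).trans one_le_two
  have rank_MW : ∀ κ₀ t, (MW κ₀ t).rank ≤ 2 := by
    rintro κ₀ (⟨i, j, k⟩ | ⟨i, j⟩ | ⟨k, i⟩ | ⟨j, k⟩)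
    · exact rank_vecMulVec_add_le _ _ _ _
    · exact (Matrix.rank_vecMulVec_le _ _).trans one_le_two
    · exact (Matrix.rank_vecMulVec_le _ _).trans one_le_two
    · exact rank_vecMulVec_add_le _ _ _ _
  refine ⟨fun s a => MW s.1 s.2.2 a.1 a.2, fun s b => MU s.1 s.2.1 s.2.2 b.1 b.2,
    fun s c => MV s.2.1 s.2.2 c.1 c.2, ?_, fun s => ⟨rank_MW _ _, rank_MU _ _ _, rank_MV _ _⟩⟩
  funext a b c
  rw [Finset.sum_apply, Finset.sum_apply, Finset.sum_apply]
  simp only [triad_apply]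
  have key := sum_forms (fun b' => if b = b' then 1 else 0) (fun c' => if c = c' then 1 else 0)
    (fun a' => if a = a' then 1 else 0)
  simp only [LU_ind, LV_ind, LW_ind] at key
  rw [matMulTensor_entry] at key
  rw [← key]
  exact Finset.sum_congr rfl fun s _ => by ring

/-- The structured index set has `4m³ + 12m²` elements. [folklore] -/
theorem card_index (m : ℕ) :
    Fintype.card (Fin 2 × Fin 2 × ((Fin m × Fin m × Fin m) ⊕ (Fin m × Fin m) ⊕ (Fin m × Fin m)
      ⊕ (Fin m × Fin m))) = 4 * m ^ 3 + 12 * m ^ 2 := by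
  simp only [Fintype.card_prod, Fintype.card_sum, Fintype.card_fin]
  ring

end PanAggregation

open PanAggregation in
/-- **`PanAggregation`** (item `stmt-MatrixMultiplication-6605`): for every `m`, the matrix
multiplication tensor `⟨2m, 2m, 2m⟩` has a decomposition into `4m³ + 12m²` triads all of whose
probes (legs read as `2m × 2m` matrices) have rank `≤ 2` — Pan's two-fold trilinear aggregation
on the four block pairs of `⟨2m⟩ = ⟨2⟩ ⊗ ⟨m⟩`, transported to `Fin (4m³ + 12m²)`.
[cite: Pan1984, §4] -/
theorem panAggregation_proof :
    Summit.MatrixMultiplication.MatrixMultiplication.Theses.ProbeRankThreshold.PanAggregation := by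
  unfold Summit.MatrixMultiplication.MatrixMultiplication.Theses.ProbeRankThreshold.PanAggregation
  intro m
  classical
  obtain ⟨W, U, V, hdec, hrank⟩ := exists_pan_decomposition m
  let e := Fintype.equivFinOfCardEq (card_index m)
  refine ⟨fun i => W (e.symm i), fun i => U (e.symm i), fun i => V (e.symm i), ?_,
    fun i => hrank _⟩
  rw [hdec]
  exact (Equiv.sum_comp e.symm (fun s => triad (W s) (U s) (V s))).symm

end Summit.MatrixMultiplication.MatrixMultiplication.Theorems
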